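import Literature.Geometry.Riemannian.ConeRadialIsometry
import Literature.Geometry.Riemannian.NormalExpTubular
import Literature.Geometry.Riemannian.NormalExpFermi
import Mathlib.Geometry.Manifold.Instances.Sphere
import HarnessLib

/-!
# The cone over a hypersurface: injectivity on a collar (via the tubular neighbourhood theorem)

Topic `Geometry/Riemannian`; sequel of `ConeRadialIsometry.lean` (brick "PC-2" of Weinstein's
step (3) towards `Weinstein1968_exists_metric_two_le_multiplicity_of_mem_cutLocus`). There the cone
map `C(v) = exp_{ι v}((‖v‖ - 1) ν v)` over a positively `0`-homogeneous presentation
`(ι, ν) : V ∖ {0} → TM` of a hypersurface was shown to satisfy the Gauss identities. Here we add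
what the tubular neighbourhood theorem gives: when `V` is `(d+1)`-dimensional (so that its unit
sphere `S` is Mathlib's analytic manifold `sphere (0 : V) 1` modelled on `ℝᵈ`), `dim M = d + 1`,
`ι` is injective on the unit sphere with `dι_v` injective on `v^⊥`, `|ν|_g = 1` and
`ν ⊥ range dι`, the data `(ι ∘ coe, ν ∘ coe)` on `S` satisfy the hypotheses of
`exists_uniform_tube_normalExp` (Lee 2018, Thm. 5.25), whence an `ε > 0` such that

* `exists_injOn_coneMap` — the normal geodesics from the hypersurface are defined for all times
  in `(-ε, ε)`, `C` is injective on the annulus `A = {v ≠ 0, |‖v‖ - 1| < ε}`, and `dC_v` is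
  injective at every `v ∈ A`.

Proof of the last clause: if `dC_v w = 0`, write `w = α v + β`, `β ⊥ v`; pairing with `dC_v v`
and the Gauss identities give `α = 0`; then `dC_v β = ∂_s|₀ C(γ s)` along the great circle `γ`
through `v` with velocity `β`, i.e. `dE_{(σ 0, ‖v‖-1)}(σ'(0), 0)` for the sphere curve `σ = γ/‖v‖`
and the normal exponential map `E` of `S` (`velocity_normalExp_left`), which vanishes only if
`σ'(0) = 0` (`E` is a local diffeomorphism on the tube), i.e. `β = 0`. Maps INTO the sphere are only
ever curves obtained by `ContMDiff.codRestrict_sphere`; no chart of the sphere is computed.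
No definitions, no named facts (D-0026).

## References

* J. M. Lee, *Introduction to Riemannian Manifolds*, 2nd ed. (2018), Thm. 5.25 (tubular
  neighbourhoods), Thm. 6.38 [LeeRiemannianManifolds2018].
* A. Weinstein, Ann. of Math. 87 (1968) 29–41, step (3) of the proof [Weinstein1968].
-/

noncomputable section

open Bundle Set Filter Function Metric Module
open scoped Manifold ContDiff Topology RealInnerProductSpace

namespace Literature.Geometry.Riemannian

open Literature.Geometry.Lorentzian
open Literature.Geometry.Lorentzian.PseudoRiemannianMetric

variable {V : Type*} [NormedAddCommGroup V] [InnerProductSpace ℝ V] {d : ℕ}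
  [Fact (finrank ℝ V = d + 1)]
  {E : Type*} [NormedAddCommGroup E] [NormedSpace ℝ E] {H : Type*} [TopologicalSpace H]
  {I : ModelWithCorners ℝ E H} {M : Type*} [TopologicalSpace M] [ChartedSpace H M]
  [IsManifold I ∞ M] {n : ℕ∞ω} [Fact (1 ≤ n)] [FiniteDimensional ℝ E] [CompleteSpace E]
  [T2Space M] [I.Boundaryless]
  (g : PseudoRiemannianMetric I n E (TangentSpace I : M → Type _)) [g.HasLeviCivita]
  [CovariantDerivative.ContMDiffCovariantDerivative g.leviCivita 1]
  [CovariantDerivative.ContMDiffCovariantDerivative g.leviCivita ((⊤ : ℕ∞) : ℕ∞ω)]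
  {ι : V → M} {ν : Π v : V, TangentSpace I (ι v)}

omit [Fact (finrank ℝ V = d + 1)] [Fact (1 ≤ n)] [CompleteSpace E]
  [T2Space M] [I.Boundaryless] [g.HasLeviCivita]
  [CovariantDerivative.ContMDiffCovariantDerivative g.leviCivita 1]
  [CovariantDerivative.ContMDiffCovariantDerivative g.leviCivita ((⊤ : ℕ∞) : ℕ∞ω)]
  [InnerProductSpace ℝ V] in
/-- The maximal geodesic domains at equal points of `TM` agree. [folklore] -/
theorem maximalGeodesicDomain_congr_totalSpace
    (cov : CovariantDerivative I E (TangentSpace I : M → Type _)) {q q' : TangentBundle I M}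
    (h : q = q') :
    maximalGeodesicDomain cov q.proj q.2 = maximalGeodesicDomain cov q'.proj q'.2 := by
  subst h
  rfl

/-- **A uniform collar on which the cone map is an injective immersion** (see the module
docstring). Hypotheses, for all `v ≠ 0`: `v ↦ (ι v, ν v) ∈ TM` is `C^∞` on `V ∖ {0}` and positively
`0`-homogeneous; `g(ν v, ν v) = 1`; `ν v ⊥_g range dι_v`; `dι_v` is injective on `v^⊥`; `ι` is
injective on the unit sphere; `dim V = dim M = d + 1`. Conclusion: there is `ε > 0` such that the
normal geodesics are defined on `(-ε, ε)`, `C(v) = exp_{ι v}((‖v‖ - 1) ν v)` is injective on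
`{v ≠ 0 | ‖v‖ - 1 ∈ (-ε, ε)}`, and `dC_v` is injective there.
[cite: LeeRiemannianManifolds2018, Thm. 5.25] [cite: Weinstein1968, main theorem (step 3 of the proof)] -/
theorem exists_injOn_coneMap
    (hs : ContMDiffOn 𝓘(ℝ, V) I.tangent ∞
      (fun v ↦ (TotalSpace.mk' E (ι v) (ν v) : TangentBundle I M)) {v : V | v ≠ 0})
    (hhom : ∀ v : V, v ≠ 0 → ∀ t : ℝ, 0 < t →
      (TotalSpace.mk' E (ι (t • v)) (ν (t • v)) : TangentBundle I M) = TotalSpace.mk' E (ι v) (ν v))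
    (hunit : ∀ v : V, v ≠ 0 → g.val (ι v) (ν v) (ν v) = 1)
    (hperp : ∀ v : V, v ≠ 0 → ∀ z : V, g.val (ι v) (mfderiv 𝓘(ℝ, V) I ι v z) (ν v) = 0)
    (himm : ∀ v : V, v ≠ 0 → ∀ z : V, ⟪v, z⟫ = 0 → mfderiv 𝓘(ℝ, V) I ι v z = 0 → z = 0)
    (hinj : ∀ v w : V, ‖v‖ = 1 → ‖w‖ = 1 → ι v = ι w → v = w)
    (hdimE : finrank ℝ E = d + 1) :
    ∃ ε : ℝ, 0 < ε ∧
      (∀ v : V, v ≠ 0 → ∀ t ∈ Ioo (-ε) ε, t ∈ maximalGeodesicDomain g.leviCivita (ι v) (ν v)) ∧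
      InjOn (fun v : V ↦ expMap g.leviCivita (ι v) ((‖v‖ - 1) • ν v))
        {v : V | v ≠ 0 ∧ ‖v‖ - 1 ∈ Ioo (-ε) ε} ∧
      ∀ v : V, v ≠ 0 → ‖v‖ - 1 ∈ Ioo (-ε) ε →
        Injective (mfderiv 𝓘(ℝ, V) I (fun v : V ↦ expMap g.leviCivita (ι v) ((‖v‖ - 1) • ν v)) v) := by
  haveI : FiniteDimensional ℝ V := .of_fact_finrank_eq_succ d
  -- the hypersurface data on the sphere
  set ιs : sphere (0 : V) 1 → M := fun z ↦ ι z with hιs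
  set νs : Π z : sphere (0 : V) 1, TangentSpace I (ιs z) := fun z ↦ ν z with hνs
  have hz0 : ∀ z : sphere (0 : V) 1, (z : V) ≠ 0 := fun z ↦ ne_zero_of_mem_unit_sphere z
  have hιd : ∀ v : V, v ≠ 0 → MDifferentiableAt 𝓘(ℝ, V) I ι v := by
    intro v hv
    have h1 : ContMDiffAt 𝓘(ℝ, V) I.tangent ∞
        (fun v ↦ (TotalSpace.mk' E (ι v) (ν v) : TangentBundle I M)) v :=
      (hs v hv).contMDiffAt (isOpen_ne.mem_nhds hv)
    rw [ModelWithCorners.tangent, Bundle.contMDiffAt_totalSpace] at h1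
    exact h1.1.mdifferentiableAt (by simp)
  have hνsmooth : ContMDiff (𝓡 d) I.tangent ∞
      (fun z : sphere (0 : V) 1 ↦ (TotalSpace.mk' E (ιs z) (νs z) : TangentBundle I M)) :=
    hs.comp_contMDiff contMDiff_coe_sphere fun z ↦ hz0 z
  have hinjs : Injective ιs := by
    intro z w h
    exact Subtype.ext (hinj _ _ (by simp) (by simp) h)
  have hcoed : ∀ z : sphere (0 : V) 1,
      MDifferentiableAt (𝓡 d) 𝓘(ℝ, V) ((↑) : sphere (0 : V) 1 → V) z :=
    fun z ↦ (contMDiff_coe_sphere (m := ∞) z).mdifferentiableAt (by simp)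
  have hmf : ∀ z : sphere (0 : V) 1, mfderiv (𝓡 d) I ιs z =
      (mfderiv 𝓘(ℝ, V) I ι z).comp (mfderiv (𝓡 d) 𝓘(ℝ, V) ((↑) : sphere (0 : V) 1 → V) z) :=
    fun z ↦ mfderiv_comp z (hιd _ (hz0 z)) (hcoed z)
  have hrange : ∀ (z : sphere (0 : V) 1) (ξ : TangentSpace (𝓡 d) z),
      ⟪(z : V), mfderiv (𝓡 d) 𝓘(ℝ, V) ((↑) : sphere (0 : V) 1 → V) z ξ⟫ = 0 := by
    intro z ξ
    have h1 : mfderiv (𝓡 d) 𝓘(ℝ, V) ((↑) : sphere (0 : V) 1 → V) z ξ ∈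
        (mfderiv (𝓡 d) 𝓘(ℝ, V) ((↑) : sphere (0 : V) 1 → V) z).range := ⟨ξ, rfl⟩
    rw [range_mfderiv_coe_sphere z] at h1
    exact (Submodule.mem_orthogonal_singleton_iff_inner_right.1 h1)
  have himms : ∀ z : sphere (0 : V) 1, Injective (mfderiv (𝓡 d) I ιs z) := by
    intro z
    rw [injective_iff_map_eq_zero]
    intro ξ hξ
    rw [hmf z, ContinuousLinearMap.comp_apply] at hξ
    have h1 := himm _ (hz0 z) _ (hrange z ξ) hξ
    exact (injective_iff_map_eq_zero _).1 (mfderiv_coe_sphere_injective z) ξ h1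
  have htranss : ∀ z : sphere (0 : V) 1, νs z ∉ Set.range (mfderiv (𝓡 d) I ιs z) := by
    rintro z ⟨ξ, hξ⟩
    have h1 : g.val (ι z) (mfderiv (𝓡 d) I ιs z ξ) (νs z) = 0 := by
      rw [hmf z, ContinuousLinearMap.comp_apply]
      exact hperp _ (hz0 z) _
    rw [hξ] at h1
    have h2 := hunit _ (hz0 z)
    rw [show g.val (ι ↑z) (ν ↑z) (ν ↑z) = g.val (ι z) (νs z) (νs z) from rfl, h1] at h2
    exact zero_ne_one h2
  have hdim : finrank ℝ (EuclideanSpace ℝ (Fin d)) + 1 = finrank ℝ E := by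
    rw [finrank_euclideanSpace_fin, hdimE]
  obtain ⟨ε, hε, hdoms, hlocs, hinjOns⟩ :=
    exists_uniform_tube_normalExp (cov := g.leviCivita) (k := (⊤ : ℕ∞)) le_top hνsmooth hinjs
      himms htranss hdim
  -- Cartesian transfer
  have zmem : ∀ v : V, v ≠ 0 → ‖v‖⁻¹ • v ∈ sphere (0 : V) 1 := fun v hv ↦ by
    simp [norm_smul, hv]
  set zOf : Π v : V, v ≠ 0 → sphere (0 : V) 1 := fun v hv ↦ ⟨‖v‖⁻¹ • v, zmem v hv⟩ with hzOf
  have hTM : ∀ (v : V) (hv : v ≠ 0),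
      (TotalSpace.mk' E (ι v) (ν v) : TangentBundle I M) =
        TotalSpace.mk' E (ιs (zOf v hv)) (νs (zOf v hv)) := fun v hv ↦
    (hhom v hv ‖v‖⁻¹ (inv_pos.2 (norm_pos_iff.2 hv))).symm
  set NEs : sphere (0 : V) 1 × ℝ → M := fun q ↦ expMap g.leviCivita (ιs q.1) (q.2 • νs q.1) with hNEs
  have hC : ∀ (v : V) (hv : v ≠ 0),
      expMap g.leviCivita (ι v) ((‖v‖ - 1) • ν v) = NEs (zOf v hv, ‖v‖ - 1) := fun v hv ↦
    expMap_smul_congr_totalSpace g.leviCivita (hTM v hv) _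
  have hdomV : ∀ v : V, v ≠ 0 → ∀ t ∈ Ioo (-ε) ε,
      t ∈ maximalGeodesicDomain g.leviCivita (ι v) (ν v) := by
    intro v hv t ht
    rw [maximalGeodesicDomain_congr_totalSpace g.leviCivita (hTM v hv)]
    exact hdoms (zOf v hv) t ht
  refine ⟨ε, hε, hdomV, ?_, ?_⟩
  · /- injectivity on the annulus -/
    rintro v ⟨hv, hvε⟩ w ⟨hw, hwε⟩ hvw
    have h1 : NEs (zOf v hv, ‖v‖ - 1) = NEs (zOf w hw, ‖w‖ - 1) := by
      rw [← hC v hv, ← hC w hw]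
      exact hvw
    have h2 := hinjOns (mk_mem_prod (mem_univ _) hvε) (mk_mem_prod (mem_univ _) hwε) h1
    rw [Prod.mk.injEq] at h2
    obtain ⟨h3, h4⟩ := h2
    have hn : ‖v‖ = ‖w‖ := by linarith
    have h5 : ‖v‖⁻¹ • v = ‖w‖⁻¹ • w := by
      have := congrArg Subtype.val h3
      exact this
    rw [hn] at h5
    exact smul_right_injective V (inv_ne_zero (norm_ne_zero_iff.2 hw)) h5
  · /- injectivity of the differential -/
    intro v hv hvε
    set C : V → M := fun v ↦ expMap g.leviCivita (ι v) ((‖v‖ - 1) • ν v) with hCdef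
    -- the annulus as the open set of the Gauss identities
    set A : Set V := {v : V | v ≠ 0} ∩ {w : V | ‖w‖ - 1 ∈ Ioo (-ε) ε} with hA
    have hAo : IsOpen A := isOpen_ne.inter (isOpen_Ioo.preimage (continuous_norm.sub continuous_const))
    have h0A : (0 : V) ∉ A := fun h ↦ h.1 rfl
    have hvA : v ∈ A := ⟨hv, hvε⟩
    have hsA := hs.mono (inter_subset_left : A ⊆ {v : V | v ≠ 0})
    have hdomA : ∀ w ∈ A, (‖w‖ - 1) ∈ maximalGeodesicDomain g.leviCivita (ι w) (ν w) :=
      fun w hw ↦ hdomV w hw.1 _ hw.2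
    have hhomA : ∀ w ∈ A, ∀ t : ℝ, 0 < t →
        (TotalSpace.mk' E (ι (t • w)) (ν (t • w)) : TangentBundle I M) =
          TotalSpace.mk' E (ι w) (ν w) := fun w hw t ht ↦ hhom w hw.1 t ht
    have hvn : 0 < ‖v‖ := norm_pos_iff.2 hv
    -- Gauss identities at `v`
    have G1 := val_mfderiv_coneMap_self_self g hAo h0A hsA hdomA hhomA hvA
    rw [hunit v hv, mul_one] at G1
    have G2 : ∀ β : V, ⟪v, β⟫ = 0 → g.val (C v) (mfderiv 𝓘(ℝ, V) I C v v)
        (mfderiv 𝓘(ℝ, V) I C v β) = 0 := fun β hβ ↦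
      val_mfderiv_coneMap_self_of_inner_eq_zero g isOpen_ne (fun h ↦ h rfl) hs hε hdomV
        (fun w hw t ht ↦ hhom w hw t ht) hunit hperp hvε
        (fun w hw ↦ by show w ≠ 0; rw [← norm_pos_iff, hw]; exact hvn) hβ
    rw [injective_iff_map_eq_zero]
    intro w hw
    change V at w
    -- decompose `w = α v + β`
    set α : ℝ := (‖v‖ ^ 2)⁻¹ * ⟪v, w⟫ with hα
    set β : V := w - α • v with hβdef
    have hvv : ⟪v, v⟫ = ‖v‖ ^ 2 := real_inner_self_eq_norm_sq v
    have hβ : ⟪v, β⟫ = 0 := by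
      rw [hβdef, inner_sub_right, inner_smul_right, hvv, hα]
      field_simp
      ring
    have hwdec : w = α • v + β := by rw [hβdef]; abel
    -- `α = 0`
    have hα0 : α = 0 := by
      have e0 : mfderiv 𝓘(ℝ, V) I C v w =
          α • mfderiv 𝓘(ℝ, V) I C v v + mfderiv 𝓘(ℝ, V) I C v β := by
        have ea : mfderiv 𝓘(ℝ, V) I C v (α • v + β : V) =
            mfderiv 𝓘(ℝ, V) I C v (α • v : V) + mfderiv 𝓘(ℝ, V) I C v β :=
          (mfderiv 𝓘(ℝ, V) I C v).map_add (α • v) β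
        have eb : mfderiv 𝓘(ℝ, V) I C v (α • v : V) = α • mfderiv 𝓘(ℝ, V) I C v v :=
          (mfderiv 𝓘(ℝ, V) I C v).map_smul α v
        have key : ∀ x : V, x = α • v + β → mfderiv 𝓘(ℝ, V) I C v x =
            α • mfderiv 𝓘(ℝ, V) I C v v + mfderiv 𝓘(ℝ, V) I C v β := by
          rintro x rfl
          exact ea.trans (by rw [eb])
        exact key w hwdec
      have h1 : g.val (C v) (mfderiv 𝓘(ℝ, V) I C v v) (mfderiv 𝓘(ℝ, V) I C v w) = α * ‖v‖ ^ 2 := by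
        rw [e0, map_add, map_smul, G2 β hβ, add_zero, smul_eq_mul]
        show α * g.val (C v) (mfderiv 𝓘(ℝ, V) I C v v) (mfderiv 𝓘(ℝ, V) I C v v) = α * ‖v‖ ^ 2
        rw [G1]
      have hw' : mfderiv 𝓘(ℝ, V) I C v w = 0 := hw
      rw [hw', map_zero] at h1
      have h2 : α * ‖v‖ ^ 2 = 0 := h1.symm
      rcases mul_eq_zero.1 h2 with h | h
      · exact h
      · exact absurd h (by positivity)
    have hwβ : w = β := by rw [hwdec, hα0, zero_smul, zero_add]
    have hβ0 : mfderiv 𝓘(ℝ, V) I C v β = 0 := by rw [← hwβ]; exact hw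
    -- `β = 0` through the sphere curve
    by_contra hβne
    rw [hwβ] at hβne
    set γc : ℝ → V := fun s ↦ Real.cos (‖β‖ / ‖v‖ * s) • v +
      Real.sin (‖β‖ / ‖v‖ * s) • ((‖v‖ / ‖β‖) • β) with hγc
    have hγn : ∀ s, ‖γc s‖ = ‖v‖ := fun s ↦ norm_greatCircle hv hβne hβ s
    have hγ0 : γc 0 = v := greatCircle_zero v β
    have hγne : ∀ s, γc s ≠ 0 := fun s h ↦ by
      have := hγn s; rw [h, norm_zero] at this; exact hvn.ne this
    have hγd : HasDerivAt γc β 0 := hasDerivAt_greatCircle_zero hv hβne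
    have hγs : ContDiff ℝ ∞ γc := by
      have h1 : ContDiff ℝ ∞ fun s : ℝ ↦ ‖β‖ / ‖v‖ * s := contDiff_const.mul contDiff_id
      exact ((Real.contDiff_cos.comp h1).smul contDiff_const).add
        ((Real.contDiff_sin.comp h1).smul contDiff_const)
    -- the sphere curve `σ = γc / ‖v‖`
    have hσmem : ∀ s, ‖v‖⁻¹ • γc s ∈ sphere (0 : V) 1 := fun s ↦ by
      simp [norm_smul, hγn s, hvn.ne']
    set σ : ℝ → sphere (0 : V) 1 := Set.codRestrict (fun s ↦ ‖v‖⁻¹ • γc s) (sphere (0 : V) 1) hσmem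
      with hσ
    have hσs : ContMDiff 𝓘(ℝ, ℝ) (𝓡 d) ∞ σ :=
      ((contDiff_const.smul hγs).contMDiff).codRestrict_sphere hσmem
    have hσd : MDifferentiableAt 𝓘(ℝ, ℝ) (𝓡 d) σ 0 := (hσs 0).mdifferentiableAt (by simp)
    -- `C ∘ γc = E_S (σ ·, ‖v‖ - 1)`
    have hzσ : ∀ s, zOf (γc s) (hγne s) = σ s := fun s ↦ by
      apply Subtype.ext
      show ‖γc s‖⁻¹ • γc s = ‖v‖⁻¹ • γc s
      rw [hγn s]
    have hfun : (C ∘ γc) = fun s ↦ NEs (σ s, ‖v‖ - 1) := by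
      funext s
      show expMap g.leviCivita (ι (γc s)) ((‖γc s‖ - 1) • ν (γc s)) = NEs (σ s, ‖v‖ - 1)
      rw [hC (γc s) (hγne s), hzσ s, hγn s]
    -- `dC_v β = velocity (C ∘ γc) 0`
    have hCd : MDifferentiableAt 𝓘(ℝ, V) I C v :=
      ((contMDiffOn_coneMap g hAo h0A hsA hdomA v hvA).contMDiffAt (hAo.mem_nhds hvA)).mdifferentiableAt
        (by simp)
    have hvel : velocity I (C ∘ γc) 0 = mfderiv 𝓘(ℝ, V) I C v β :=
      velocity_comp_of_hasDerivAt_normedSpace (F := C) (c := γc) (t := 0) (w := v) hγ0 hCd hγd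
    -- `velocity (s ↦ E_S (σ s, t₀)) 0 = dE_S (σ' 0, 0)`
    have hNEd : MDifferentiableAt ((𝓡 d).prod 𝓘(ℝ, ℝ)) I NEs (σ 0, ‖v‖ - 1) :=
      (hlocs (σ 0) _ hvε).contMDiffAt.mdifferentiableAt (by simp)
    have hvel2 := velocity_normalExp_left (I := I) (I' := 𝓡 d) (cov := g.leviCivita) (ι := ιs)
      (ν := νs) (t := ‖v‖ - 1) hσd hNEd
    -- hence `dE_S (σ' 0, 0) = 0`
    have hzero : mfderiv ((𝓡 d).prod 𝓘(ℝ, ℝ)) I NEs (σ 0, ‖v‖ - 1)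
        ((velocity (𝓡 d) σ 0, (0 : ℝ)) : TangentSpace ((𝓡 d).prod 𝓘(ℝ, ℝ)) (σ 0, ‖v‖ - 1)) = 0 := by
      rw [← hvel2]
      have h1 : (fun s : ℝ ↦ expMap g.leviCivita (ιs (σ s)) ((‖v‖ - 1) • νs (σ s))) = C ∘ γc := by
        rw [hfun]
      rw [velocity_congr_of_eventuallyEq (Filter.EventuallyEq.of_eq h1), hvel, hβ0]
      rfl
    -- `dE_S` is injective at points of the tube, so `σ' 0 = 0`
    have hinjNE : Injective (mfderiv ((𝓡 d).prod 𝓘(ℝ, ℝ)) I NEs (σ 0, ‖v‖ - 1)) := by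
      have hn0 : ((⊤ : ℕ∞) : ℕ∞ω) ≠ 0 := by simp
      have hc := IsLocalDiffeomorphAt.mfderivToContinuousLinearEquiv_coe (hlocs (σ 0) _ hvε) hn0
      rw [← hc]
      exact ((hlocs (σ 0) _ hvε).mfderivToContinuousLinearEquiv hn0).injective
    have hσ' : velocity (𝓡 d) σ 0 = 0 := by
      have h1 := (injective_iff_map_eq_zero _).1 hinjNE _ hzero
      exact (Prod.mk.inj h1).1
    -- but `coe ∘ σ = γc / ‖v‖` has nonzero velocity
    have hcoe : velocity 𝓘(ℝ, V) (fun s ↦ ((σ s : sphere (0 : V) 1) : V)) 0 =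
        mfderiv (𝓡 d) 𝓘(ℝ, V) ((↑) : sphere (0 : V) 1 → V) (σ 0) (velocity (𝓡 d) σ 0) := by
      simp only [velocity]
      have h : (fun s ↦ ((σ s : sphere (0 : V) 1) : V)) = ((↑) : sphere (0 : V) 1 → V) ∘ σ := rfl
      rw [h, mfderiv_comp 0 (hcoed (σ 0)) hσd]
      rfl
    rw [hσ', map_zero] at hcoe
    have hcoe2 : velocity 𝓘(ℝ, V) (fun s ↦ ((σ s : sphere (0 : V) 1) : V)) 0 = ‖v‖⁻¹ • β := by
      have hder : HasDerivAt (fun s ↦ ‖v‖⁻¹ • γc s) (‖v‖⁻¹ • β) 0 := hγd.const_smul ‖v‖⁻¹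
      have h := velocity_comp_of_hasDerivAt_normedSpace (I := 𝓘(ℝ, V)) (F := (id : V → V))
        (c := fun s ↦ ‖v‖⁻¹ • γc s) (t := 0) (w := ‖v‖⁻¹ • γc 0) rfl mdifferentiableAt_id hder
      rw [mfderiv_id] at h
      exact h
    rw [hcoe2] at hcoe
    exact hβne ((smul_eq_zero.1 hcoe).resolve_left (inv_ne_zero hvn.ne'))

end Literature.Geometry.Riemannian

end
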